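import Literature.MathematicalPhysics.QuantumFieldTheory.Balaban1983to89.B13Eq240Printed
import Literature.MathematicalPhysics.QuantumFieldTheory.Balaban1983to89.B13Ineq240

/-!
# `Balaban1983to89.B13Eq240Bridge` — (2.40) of T. Bałaban, *Renormalization group approach to lattice gauge field
theories. II. Cluster expansions*, Commun. Math. Phys. **116**, 1–22 (1988) [Balaban1988RG2Cluster], p. 21, in the
fold owner's PRINTED-LETTER form `B13Ineq240.Ineq240` (r10, p246336), DERIVED from Lemma 3's bound (2.38) by the
printed [26]-route of `B13Eq240TreeGraph`/`B13Eq240Printed` (p24) — the one-theorem bridge between the two stems of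
SKELETON row B13.Eq2.40 (owner ruling 2026-08-21T03:27:33Z, lead ruling G.5-41(b))

statement-level skeleton of published theorems with citation tags; proofs where landed; nothing here is a claim about the Yang–Mills mass gap

PDF held: `paper:balaban1988-cmp116-rg-ii-cluster` (journal page = PDF page; p. 21 read this session).

WHAT IS REPRODUCED = SKELETON row **B13.Eq2.40**, unit `lit-balaban-p24` (Phase-2 proof seat p24, gen 2; HOME
`run/shared/lean/pub/lit-balaban/`).  P. 21 [PDF 21], verbatim: *"To the above sum we can repeat all the considerations
and bounds of the paper [26], for κ sufficiently large, and ε₁ sufficiently small. We obtain* `|E^{(k+1)}(X)| ≤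
exp(−(1 − 9δ)½Lκd_{k+1}(X)) exp(−5κ) · Σ_{Z⊂X} C₃ε₁ exp 5κ exp(−½δLκd_{k+1}(Z)) O(1) exp 2(LM)⁻⁴|Z|.` (2.40)".

WHAT IS PROVED (0 sorry): **`ineq240_of_bound238`** — on the abstract step data `B13.StepData` with the polymer
geometry `B13Resummation.Geometry` (footprints, the incompatibility of (2.11) with its locality, (1.26), (2.30)
additive, (2.27)), the restriction property of the spaces (p. 15, `SpRestr`) and the PRINTED representation (2.13) of
`E^{(k+1)}(X)` (`B13MayerDecoupling.ursellSeries213`): Lemma 3's (2.38) (`B13.Bound238`) ⇒ (2.40) AS PRINTED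
(`B13Ineq240.Ineq240 S c G.cubes 2`, printed `O(1) = 2`), with "κ sufficiently large" := `κ₀ + c₁ ≤ ½δLκ` and
"ε₁ sufficiently small" := `8ν · C₃ε₁ e^{5(1−9δ)½Lκ} e^{c₁} K₀ ≤ 1`.  The merging exponent of (2.39) (print *"exp 5κ"*,
honest `5(1 − 9δ)½Lκ`) CANCELS between the prefactor `exp(−b)` and the weights `C₃ε₁ exp b`, so the display holds
with the printed `exp(−5κ) … exp 5κ` verbatim; the honest exponent survives only inside the smallness condition.
Then `B13Ineq240.bound241_of_ineq240_geometry` (r10) or `B13Eq240Printed.cammarotaStep_of_treeGraph` (p24) give (2.41).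
-/

open Finset

noncomputable section

namespace Literature.MathematicalPhysics.QuantumFieldTheory.Balaban1983to89.B13Eq240Bridge

open Literature.MathematicalPhysics.QuantumFieldTheory.Balaban1983to89.B13Resummation (Geometry SpRestr)
open Literature.MathematicalPhysics.QuantumFieldTheory.Balaban1983to89.B13MayerDecoupling (ursellSeries213)
open Literature.MathematicalPhysics.QuantumFieldTheory.Balaban1983to89.B13UrsellKPSeries (zetaOf zetaOf_01 zetaOf_symm
  zetaOf_eq_zero_iff)
open Literature.MathematicalPhysics.QuantumFieldTheory.Balaban1983to89.B13Eq240TreeGraph (absSeries213)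
open Literature.MathematicalPhysics.QuantumFieldTheory.Balaban1983to89.B13Eq240Printed (w239 ineq239 ineq240
  summable_absTerm213_w239)
open Literature.MathematicalPhysics.QuantumFieldTheory.Balaban1983to89.B13Ineq240 (term240 lastSum240 Ineq240)
open Literature.MathematicalPhysics.QuantumFieldTheory.Balaban1983to89.B13FamilySum (inside)

open Classical in
/-- **(2.38) ⇒ (2.40) AS PRINTED, by the [26]-route** (p. 21: *"To the above sum we can repeat all the considerations
and bounds of the paper [26], for κ sufficiently large, and ε₁ sufficiently small. We obtain (2.40)"*): given the
polymer geometry of 𝐃_{k+1}, the restriction property of the spaces and the printed representation (2.13) of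
`E^{(k+1)}(X)`, Lemma 3's bound `B13.Bound238 S c` implies the fold owner's printed-letter display
`B13Ineq240.Ineq240 S c G.cubes 2` (`|E^{(k+1)}(X)| ≤ exp(−(1 − 9δ)½Lκd_{k+1}(X)) exp(−5κ) Σ_{Z⊂X} C₃ε₁ exp 5κ
exp(−½δLκd_{k+1}(Z)) · 2 · exp 2(LM)⁻⁴|Z|`), under "κ sufficiently large" := `κ₀ + c₁ ≤ ½δLκ` and
"ε₁ sufficiently small" := `8ν C₃ε₁ e^{5(1−9δ)½Lκ} e^{c₁} K₀ ≤ 1` — `B13Eq240Printed.ineq239` + `ineq240`, the merging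
exponent cancelling between prefactor and weights. [cite: Balaban1988RG2Cluster, (2.40) p.21] -/
theorem ineq240_of_bound238 (S : B13.StepData) (c : B13.Consts) {Cube : Type} [DecidableEq Cube]
    (G : Geometry S.Dk1 Cube) (hsp : SpRestr S G)
    (hrep : ∀ X φ, φ ∈ S.sp2 X →
      S.Ek1 X φ = ursellSeries213 (zetaOf G.ι) (fun Z => S.H Z φ) G.cubes (G.cubes X))
    (h238 : B13.Bound238 S c) (hA : 0 ≤ c.C3act * c.ε₁) (hr₁ : 0 ≤ (1 - 10 * c.δ) * ((c.L : ℝ) / 2) * c.κ)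
    (hlarge : G.κ₀ + G.c₁ ≤ 1 / 2 * c.δ * (c.L : ℝ) * c.κ)
    (hsmall : 8 * G.ν * (c.C3act * c.ε₁ * Real.exp (5 * ((1 - 9 * c.δ) * ((c.L : ℝ) / 2) * c.κ)) *
      Real.exp G.c₁ * G.K₀) ≤ 1) :
    Ineq240 S c G.cubes 2 := by
  intro X φ hφ
  haveI : Std.Symm G.ι := ⟨G.ι_symm⟩
  -- letters: A = C₃ε₁, r₁ = (1 − 10δ)½Lκ, r = ½δLκ, b = 5(r₁ + r) (honest merging exponent), c = 5
  set A : ℝ := c.C3act * c.ε₁ with hAdef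
  set r₁ : ℝ := (1 - 10 * c.δ) * ((c.L : ℝ) / 2) * c.κ with hr₁def
  set r : ℝ := 1 / 2 * c.δ * (c.L : ℝ) * c.κ with hrdef
  set b : ℝ := 5 * (r₁ + r) with hbdef
  have hb9 : 5 * (r₁ + r) = 5 * ((1 - 9 * c.δ) * ((c.L : ℝ) / 2) * c.κ) := by rw [hr₁def, hrdef]; ring
  have hr : 0 ≤ r₁ + r := by
    have : 0 ≤ r := by rw [hrdef]; linarith [G.κ₀_nonneg, G.c₁_nonneg]
    linarith
  -- (2.38) on the polymers inside `X`, exponent `(1 − 8δ)½Lκ = r₁ + 2r`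
  have hH : ∀ Z, G.cubes Z ⊆ G.cubes X → ‖S.H Z φ‖ ≤ A * Real.exp (-((r₁ + 2 * r) * S.Dk1.dj Z)) := by
    intro Z hZ
    have h := h238 Z φ (hsp X Z φ hZ hφ)
    have hrate : (1 - 8 * c.δ) * ((c.L : ℝ) / 2) * c.κ * S.Dk1.dj Z = (r₁ + 2 * r) * S.Dk1.dj Z := by
      rw [hr₁def, hrdef]; ring
    rwa [hrate] at h
  have hloc : ∀ Z Z', zetaOf G.ι Z' Z = 0 → ∃ q ∈ G.reach Z, q ∈ G.cubes Z' :=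
    fun Z Z' h0 => G.loc Z Z' (zetaOf_eq_zero_iff.1 h0)
  have hsmallb : 8 * G.ν * (A * Real.exp b * Real.exp G.c₁ * G.K₀) ≤ 1 := by
    rw [hbdef, hb9]; exact hsmall
  have hsum := summable_absTerm213_w239 (ζ := zetaOf G.ι) (cubes := G.cubes) (reach := G.reach) (d := S.Dk1.dj)
    (zetaOf_01 (ι := G.ι)) zetaOf_symm hloc G.reach_le G.ν_nonneg S.Dk1.dj_nonneg hA G.K₀_nonneg G.ineq126
    G.volBound hlarge hsmallb (G.cubes X) (b := b)
  have h239 := ineq239 (ζ := zetaOf G.ι) (cubes := G.cubes) (d := S.Dk1.dj) hA hr (by norm_num : (0 : ℝ) ≤ 5) hbdef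
    S.Dk1.dj_nonneg hH (G.ineq227 X) hsum
  have h240 := ineq240 (ζ := zetaOf G.ι) (cubes := G.cubes) (reach := G.reach) (d := S.Dk1.dj)
    (zetaOf_01 (ι := G.ι)) zetaOf_symm hloc G.reach_le G.ν_nonneg S.Dk1.dj_nonneg hA G.K₀_nonneg G.ineq126
    G.volBound hlarge hsmallb (G.cubes X) (b := b)
  have hpref : 0 ≤ Real.exp (-((r₁ + r) * S.Dk1.dj X)) * Real.exp (-b) := by positivity
  -- the merging exponent cancels: e^{−b}·(A e^{b} …) = e^{−5κ}·(C₃ε₁ e^{5κ} …) termwise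
  have e1 : Real.exp (-b) * Real.exp b = 1 := by rw [← Real.exp_add, neg_add_cancel, Real.exp_zero]
  have e2 : Real.exp (-(5 * c.κ)) * Real.exp (5 * c.κ) = 1 := by rw [← Real.exp_add, neg_add_cancel, Real.exp_zero]
  have hterm : ∀ Z, Real.exp (-b) * (w239 S.Dk1.dj A b r Z * (2 * Real.exp (2 * ((G.cubes Z).card : ℝ)))) =
      Real.exp (-(5 * c.κ)) * term240 S c G.cubes 2 Z := by
    intro Z
    unfold w239 term240
    calc Real.exp (-b) * (A * Real.exp b * Real.exp (-(r * S.Dk1.dj Z)) * (2 * Real.exp (2 * ((G.cubes Z).card : ℝ))))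
        = (Real.exp (-b) * Real.exp b) *
            (A * Real.exp (-(r * S.Dk1.dj Z)) * (2 * Real.exp (2 * ((G.cubes Z).card : ℝ)))) := by ring
      _ = (Real.exp (-(5 * c.κ)) * Real.exp (5 * c.κ)) *
            (A * Real.exp (-(r * S.Dk1.dj Z)) * (2 * Real.exp (2 * ((G.cubes Z).card : ℝ)))) := by rw [e1, e2]
      _ = Real.exp (-(5 * c.κ)) * (c.C3act * c.ε₁ * Real.exp (5 * c.κ) *
            Real.exp (-(1 / 2 * c.δ * (c.L : ℝ) * c.κ * S.Dk1.dj Z)) * 2 *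
              Real.exp (2 * ((G.cubes Z).card : ℝ))) := by rw [hAdef, hrdef]; ring
  have hsumEq : ∑ Z ∈ inside (Finset.univ : Finset S.Dk1.Dom) G.cubes (G.cubes X),
      Real.exp (-b) * (w239 S.Dk1.dj A b r Z * (2 * Real.exp (2 * ((G.cubes Z).card : ℝ)))) =
      Real.exp (-(5 * c.κ)) * lastSum240 S c G.cubes 2 X := by
    rw [lastSum240, Finset.mul_sum]
    exact Finset.sum_congr rfl fun Z _ => hterm Z
  have hrate' : -((r₁ + r) * S.Dk1.dj X) = -((1 - 9 * c.δ) * ((c.L : ℝ) / 2) * c.κ * S.Dk1.dj X) := by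
    rw [hr₁def, hrdef]; ring
  rw [hrep X φ hφ]
  calc ‖ursellSeries213 (zetaOf G.ι) (fun Z => S.H Z φ) G.cubes (G.cubes X)‖
      ≤ Real.exp (-((r₁ + r) * S.Dk1.dj X)) * Real.exp (-b) *
          absSeries213 (zetaOf G.ι) (w239 S.Dk1.dj A b r) G.cubes (G.cubes X) := h239
    _ ≤ Real.exp (-((r₁ + r) * S.Dk1.dj X)) * Real.exp (-b) *
          ∑ Z ∈ inside (Finset.univ : Finset S.Dk1.Dom) G.cubes (G.cubes X),
            w239 S.Dk1.dj A b r Z * (2 * Real.exp (2 * ((G.cubes Z).card : ℝ))) :=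
        mul_le_mul_of_nonneg_left h240 hpref
    _ = Real.exp (-((r₁ + r) * S.Dk1.dj X)) *
          ∑ Z ∈ inside (Finset.univ : Finset S.Dk1.Dom) G.cubes (G.cubes X),
            Real.exp (-b) * (w239 S.Dk1.dj A b r Z * (2 * Real.exp (2 * ((G.cubes Z).card : ℝ)))) := by
        rw [mul_assoc, Finset.mul_sum]
    _ = Real.exp (-((r₁ + r) * S.Dk1.dj X)) * (Real.exp (-(5 * c.κ)) * lastSum240 S c G.cubes 2 X) := by
        rw [hsumEq]
    _ = Real.exp (-((1 - 9 * c.δ) * ((c.L : ℝ) / 2) * c.κ * S.Dk1.dj X)) * Real.exp (-(5 * c.κ)) *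
          lastSum240 S c G.cubes 2 X := by
        rw [hrate']; ring

end Literature.MathematicalPhysics.QuantumFieldTheory.Balaban1983to89.B13Eq240Bridge
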